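import Summits.ResolutionOfSingularities.ResolutionOfSingularities.Theorems.PurelyInseparableDim4ChartAtlasSNCFarRepairChart
import Summits.ResolutionOfSingularities.ResolutionOfSingularities.Theorems.PurelyInseparableDim4ChartAtlasSNCFarRepairStep
import Summits.ResolutionOfSingularities.ResolutionOfSingularities.Theorems.PurelyInseparableDim4ChartAtlasGlue
import Summits.ResolutionOfSingularities.ResolutionOfSingularities.Theorems.PurelyInseparableDim4ChartAtlasSNCRepairGlobal
import HarnessLib

/-!
# Purely inseparable four-folds `z^p + F(x₁, …, x₄)`: the FAR-RESONANCE REPAIR on the blown-up scheme — after blowing up the resonance locus `Σ`,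
# the strict transform of the escaping centre is snc with the whole transformed boundary (S3-N2 repair, far class, step 4; typ-2 g6)

[OURS · counted 0] (D-0157 DOOR 2; DR-157-C; desk WORD #115 (a)/(c), #131 (c); crit-3 g5's (b)). The far analogue of p695136
(`hasSNCWith_transform_boundary_strictTransform_after_repair`). Chart model of the escaping step in the translated frame `y_j ↦ y_j - c'` (p699206
§2): boundary `E` of hyperplanes `(y_m + a)·𝒪`, `(m, a) ∈ H₀`, and translated far quadrics `TQ_k = ((y_k + b_k)·y_j - c'·y_k + e_k)·𝒪`, `k ∈ fs`
(RESONANT iff `k ∈ T` and `e_k = 0`); escaping centre `Zc = V(y_0, y_T)` (`j ∉ T`); resonance locus `Σ = Zc ∩ {y_j = 0} = V(y_0, y_T, y_j)`. For ANY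
blowing up `π' : W' → 𝔸⁵` along `Σ` — PROVED here (no `sorry`, no new axiom):

* **`hasSNCWith_transform_boundary_strictTransform_after_farRepair`** — `HasSNCWith (E.map St_{π'} ++ [E_Σ]) (St_{π'} 𝓘_{Zc})` as soon as the
  hyperplanes are the ones the dictionary produces (`(k⁺, a) ∈ H₀ → a = b_k` on far indices; `(j⁺, a) ∈ H₀`, `a ≠ 0`, at no surviving cubic's
  height), `d_k = e_k + b_k·c' ≠ 0`, and the NON-resonant active far members keep pairwise distinct heights — with NO condition on the resonant
  ones: the repair has removed the far resonance.

Proof: `Σ` is snc with `E` (p706678), so `E.map St ++ [E_Σ]` is snc on `W'` (`HasSNCWith.hasSNC_transform`); `St(𝓘_{Zc})` lives on the `y_j`-chart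
only and reads `V(y_0, y_T)` there (p707037); member by member the readings of p707037 / p705352 / the hyperplane dictionary put the chart list in
the five shapes of p708112-file's `hasSNCWith_𝓘Λ_of_forall_mem_after_farRepair`; glue p692083. With St(Zc) regular and inside the support as in
p696436 this makes `St(Zc)` ADMISSIBLE after ONE extra blow-up — the cost rider r5 of the near repair applies verbatim. Nothing here is a statement
about resolution of singularities in dimension ≥ 4 / characteristic `p` (NOT proved anywhere in this programme). bears_on: LADDER-RESOLUTION:D157-DOOR2
(res-dim4-pi). Supports stmt-ResolutionOfSingularities-16155 (helper, S3-N2 far repair).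
-/

-- every declaration of this summit lives under `Summit.ResolutionOfSingularities.ResolutionOfSingularities`
-- (summit = problem), which the duplicate-namespace linter flags; house convention (cf. the Target file).
set_option linter.dupNamespace false

noncomputable section

open MvPolynomial CategoryTheory AlgebraicGeometry Opposite TopologicalSpace
open AlgebraicGeometry.Scheme.IdealSheafData (ofIdealTop)

namespace Summit.ResolutionOfSingularities.ResolutionOfSingularities.Theorems.PIDim4

open Literature.AlgebraicGeometry.Resolution
open Literature.AlgebraicGeometry.Resolution.AffinePointBlowup (P A γ coord Wtop ξ)

namespace ChartDictionary

variable {K : Type} [Field K] {T : Finset (Fin 4)} {j : Fin 4} {b e : Fin 4 → K} {c' : K} {W' : Scheme.{0}} {π' : W' ⟶ P 4 K}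

/-- A hyperplane `(y_m + a)·𝒪` CONTAINING `Σ` (`m` a variable of `Σ` other than `y_j`, `a = 0`) reads `y_m·𝒪` again on the `y_j`-chart of `Bl_Σ`. -/
theorem comap_chartImm_strictTransform_hyperplane_of_mem_after_farRepair {m : Fin (4 + 1)}
    (hm : m ∈ (insert 0 (Fin.succ '' (T : Set (Fin 4))) : Set (Fin (4 + 1)))) (hjT : j ∉ T)
    (hπ' : IsBlowup π' (AffineCoordBlowup.𝓘Λ 4 K (insert 0 (Fin.succ '' ((insert j T : Finset (Fin 4)) : Set (Fin 4)))))) :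
    (strictTransformIdeal π' (AffineCoordBlowup.𝓘Λ 4 K (insert 0 (Fin.succ '' ((insert j T : Finset (Fin 4)) : Set (Fin 4)))))
        (ofIdealTop (Ideal.span {(γ 4 K).symm (X m + C 0)}))).comap
        (AffineCoordBlowup.chartImm hπ' (succ_mem_centreVars (Finset.mem_insert_self j T))) =
      ofIdealTop (Ideal.span {(γ 4 K).symm (X m + C 0)}) := by
  have hmj : m ≠ j.succ := fun h => hjT ((succ_mem_centreVars_iff T j).mp (h ▸ hm))
  rw [C_0, add_zero, show (γ 4 K).symm (X m) = coord 4 K m from rfl, ofIdealTop_span_coord_eq_𝓘Λ]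
  exact comap_chartImm_strictTransformIdeal_𝓘Λ_of_subset hπ'
    (Set.singleton_subset_iff.mpr (centreVars_subset_centreVars_insert T j hm)) _ (fun h => hmj (Set.mem_singleton_iff.mp h).symm)

/-- A hyperplane `(y_m + a)·𝒪` MISSING `Σ` (`m` a variable of `Σ` other than `y_j`, `a ≠ 0`) reads the product quadric `(y_j·y_m + a)·𝒪`. -/
theorem comap_chartImm_strictTransform_hyperplane_of_mem_of_ne_after_farRepair {m : Fin (4 + 1)}
    (hm : m ∈ (insert 0 (Fin.succ '' (T : Set (Fin 4))) : Set (Fin (4 + 1)))) (hjT : j ∉ T) {a : K} (ha : a ≠ 0)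
    (hπ' : IsBlowup π' (AffineCoordBlowup.𝓘Λ 4 K (insert 0 (Fin.succ '' ((insert j T : Finset (Fin 4)) : Set (Fin 4)))))) :
    (strictTransformIdeal π' (AffineCoordBlowup.𝓘Λ 4 K (insert 0 (Fin.succ '' ((insert j T : Finset (Fin 4)) : Set (Fin 4)))))
        (ofIdealTop (Ideal.span {(γ 4 K).symm (X m + C a)}))).comap
        (AffineCoordBlowup.chartImm hπ' (succ_mem_centreVars (Finset.mem_insert_self j T))) =
      ofIdealTop (Ideal.span {(γ 4 K).symm (X j.succ * X m + C a)}) := by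
  have hmj : m ≠ j.succ := fun h => hjT ((succ_mem_centreVars_iff T j).mp (h ▸ hm))
  rw [strictTransformIdeal_comap_chartImm_of_constantCoeff_ne_zero (Finset.mem_insert_self j T) ?_ hπ', map_add, coordBlowupSubst_C,
    coordBlowupSubst_X_of_mem_of_ne K _ j.succ (centreVars_subset_centreVars_insert T j hm) hmj]
  rw [map_add, constantCoeff_X, constantCoeff_C, zero_add]
  exact ha

/-- A hyperplane of index `j` missing `Σ` (`a ≠ 0`) keeps its reading `(y_j + a)·𝒪`. -/
theorem comap_chartImm_strictTransform_hyperplane_j_of_ne_after_farRepair {a : K} (ha : a ≠ 0)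
    (hπ' : IsBlowup π' (AffineCoordBlowup.𝓘Λ 4 K (insert 0 (Fin.succ '' ((insert j T : Finset (Fin 4)) : Set (Fin 4)))))) :
    (strictTransformIdeal π' (AffineCoordBlowup.𝓘Λ 4 K (insert 0 (Fin.succ '' ((insert j T : Finset (Fin 4)) : Set (Fin 4)))))
        (ofIdealTop (Ideal.span {(γ 4 K).symm (X j.succ + C a)}))).comap
        (AffineCoordBlowup.chartImm hπ' (succ_mem_centreVars (Finset.mem_insert_self j T))) =
      ofIdealTop (Ideal.span {(γ 4 K).symm (X j.succ + C a)}) := by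
  rw [strictTransformIdeal_comap_chartImm_of_constantCoeff_ne_zero (Finset.mem_insert_self j T) ?_ hπ', map_add, coordBlowupSubst_C,
    coordBlowupSubst_X_self]
  rw [map_add, constantCoeff_X, constantCoeff_C, zero_add]
  exact ha

/-- A far quadric with `k ∉ T` (so `k⁺` is not a variable of `Σ`; `k ≠ j`) keeps its shape on the `y_j`-chart of `Bl_Σ` — with or without
constant term (`x_j ∤ TQ_k`: the monomial `y_k` has coefficient `-c' ≠ 0`). -/
theorem comap_chartImm_strictTransform_tquadric_of_not_mem_after_farRepair' {k : Fin 4} (hkT : k ∉ T) (hkj : k ≠ j) (hc' : c' ≠ 0)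
    (hπ' : IsBlowup π' (AffineCoordBlowup.𝓘Λ 4 K (insert 0 (Fin.succ '' ((insert j T : Finset (Fin 4)) : Set (Fin 4)))))) :
    (strictTransformIdeal π' (AffineCoordBlowup.𝓘Λ 4 K (insert 0 (Fin.succ '' ((insert j T : Finset (Fin 4)) : Set (Fin 4)))))
        (ofIdealTop (Ideal.span {(γ 4 K).symm ((X k.succ + C (b k)) * X j.succ - C c' * X k.succ + C (e k))}))).comap
        (AffineCoordBlowup.chartImm hπ' (succ_mem_centreVars (Finset.mem_insert_self j T))) =
      ofIdealTop (Ideal.span {(γ 4 K).symm ((X k.succ + C (b k)) * X j.succ - C c' * X k.succ + C (e k))}) := by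
  classical
  have hk : k ∉ insert j T := fun h => by
    rcases Finset.mem_insert.mp h with h | h
    · exact hkj h
    · exact hkT h
  have hkj' : (k.succ : Fin (4 + 1)) ≠ j.succ := fun h => hkj (Fin.succ_injective _ h)
  refine strictTransformIdeal_principal_comap_chartImm (Finset.mem_insert_self j T) 0 ?_ ?_ hπ'
  · rw [pow_zero, one_mul]
    simp only [map_add, map_sub, map_mul, coordBlowupSubst_C, coordBlowupSubst_X_self,
      coordBlowupSubst_X_of_not_mem K _ j.succ (fun h => hk ((succ_mem_centreVars_iff _ k).mp h))]
  · refine not_coord_dvd_γ_symm_of_coeff (Finsupp.single k.succ 1) (Finsupp.single_eq_of_ne hkj'.symm) ?_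
    have hne : (0 : Fin (4 + 1) →₀ ℕ) ≠ Finsupp.single k.succ 1 := (Finsupp.single_ne_zero.mpr one_ne_zero).symm
    rw [coeff_add, coeff_sub, coeff_mul_X', if_neg (by rw [Finsupp.mem_support_iff, not_not]; exact Finsupp.single_eq_of_ne hkj'.symm),
      coeff_C_mul, coeff_X, if_pos rfl, coeff_C, if_neg hne, zero_sub, add_zero, mul_one, neg_ne_zero]
    exact hc'

/-- **THE FAR-RESONANCE REPAIR ON `W'`.** `j ∉ T`, `c' ≠ 0`; chart-model boundary (translated frame): hyperplanes `(m, a) ∈ H₀` (with `a = b_k` on far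
indices `k⁺`, and no index-`j` hyperplane with `a ≠ 0` at a non-resonant far member's height), translated far quadrics `TQ_k`, `k ∈ fs ∌ j`,
`e_k + b_k·c' ≠ 0`, the non-resonant ones in `T` with pairwise distinct heights. For ANY blowing up `π'` of `𝔸⁵` along `Σ = V(y_0, y_T, y_j)`:
`HasSNCWith (E.map St ++ [E_Σ]) (St V(y_0, y_T))`. -/
theorem hasSNCWith_transform_boundary_strictTransform_after_farRepair (hjT : j ∉ T) (hc' : c' ≠ 0) (H₀ : Finset (Fin (4 + 1) × K))
    (fs : Finset (Fin 4)) (hjfs : j ∉ fs) (hd : ∀ k ∈ fs, e k + b k * c' ≠ 0) (hC1 : ∀ k ∈ fs, ∀ a : K, (k.succ, a) ∈ H₀ → a = b k)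
    (hHj : ∀ a : K, (j.succ, a) ∈ H₀ → a ≠ 0 → ∀ k ∈ fs, k ∈ T → e k ≠ 0 → b k ≠ 0 → e k ≠ a * b k)
    (hNh : ∀ k ∈ fs, ∀ k' ∈ fs, k ∈ T → k' ∈ T → e k ≠ 0 → e k' ≠ 0 → k ≠ k' → b k ≠ 0 → b k' ≠ 0 → e k * b k' ≠ e k' * b k)
    {E : List (Scheme.IdealSheafData (P 4 K))}
    (hE : ∀ D ∈ E, D = ⊤ ∨ (∃ ma ∈ H₀, D = ofIdealTop (Ideal.span {(γ 4 K).symm (X ma.1 + C ma.2)})) ∨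
      ∃ k ∈ fs, D = ofIdealTop (Ideal.span {(γ 4 K).symm ((X k.succ + C (b k)) * X j.succ - C c' * X k.succ + C (e k))}))
    (hπ' : IsBlowup π' (AffineCoordBlowup.𝓘Λ 4 K (insert 0 (Fin.succ '' ((insert j T : Finset (Fin 4)) : Set (Fin 4)))))) :
    HasSNCWith
      ((E.map (strictTransformIdeal π' (AffineCoordBlowup.𝓘Λ 4 K (insert 0 (Fin.succ '' ((insert j T : Finset (Fin 4)) : Set (Fin 4))))))) ++
        [(AffineCoordBlowup.𝓘Λ 4 K (insert 0 (Fin.succ '' ((insert j T : Finset (Fin 4)) : Set (Fin 4))))).comap π'])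
      (strictTransformIdeal π' (AffineCoordBlowup.𝓘Λ 4 K (insert 0 (Fin.succ '' ((insert j T : Finset (Fin 4)) : Set (Fin 4)))))
        (AffineCoordBlowup.𝓘Λ 4 K (insert 0 (Fin.succ '' (T : Set (Fin 4)))))) := by
  classical
  haveI : IsProper π' := hπ'.isProper
  haveI : IsLocallyNoetherian W' := LocallyOfFiniteType.isLocallyNoetherian π'
  have hj' : j ∈ insert j T := Finset.mem_insert_self j T
  set Λ : Set (Fin (4 + 1)) := insert 0 (Fin.succ '' ((insert j T : Finset (Fin 4)) : Set (Fin 4))) with hΛ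
  set ΛT : Set (Fin (4 + 1)) := insert 0 (Fin.succ '' (T : Set (Fin 4))) with hΛT
  have hsub : ΛT ⊆ Λ := centreVars_subset_centreVars_insert T j
  have hΛmem : ∀ m : Fin (4 + 1), m ∈ Λ ↔ m = j.succ ∨ m ∈ ΛT := by
    intro m
    rw [hΛ, hΛT, Set.mem_insert_iff, Set.mem_insert_iff, Set.mem_image, Set.mem_image, Finset.coe_insert]
    constructor
    · rintro (h | ⟨t, ht, rfl⟩)
      · exact Or.inr (Or.inl h)
      · rcases ht with rfl | ht
        · exact Or.inl rfl
        · exact Or.inr (Or.inr ⟨t, ht, rfl⟩)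
    · rintro (rfl | h | ⟨t, ht, rfl⟩)
      · exact Or.inr ⟨j, Set.mem_insert _ _, rfl⟩
      · exact Or.inl h
      · exact Or.inr ⟨t, Set.mem_insert_of_mem _ ht, rfl⟩
  -- (i) before: `Σ` is snc with `E` (step 1), so the transformed boundary is snc on `W'`
  have hE0 : HasSNCWith E (AffineCoordBlowup.𝓘Λ 4 K Λ) :=
    hasSNCWith_𝓘Λ_insert_of_forall_mem_far_translated hjT hc' H₀ fs hjfs hd hC1 hE
  have hsncW := hE0.hasSNC_transform hπ'
  -- (ii) glue over the single chart `y_j`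
  refine hasSNCWith_of_cover_comap (fun _ : Unit => AffineCoordBlowup.chartImm hπ' (succ_mem_centreVars hj')) hsncW ?_ fun _ => ?_
  · intro w hw
    exact Set.mem_iUnion.mpr ⟨(), support_strictTransform_escapingCentre_after_farRepair_subset hπ' hw⟩
  rw [comap_chartImm_strictTransform_escapingCentre_after_farRepair hjT hπ']
  -- (iii) after: the chart list is in the five shapes of step 3
  refine hasSNCWith_𝓘Λ_of_forall_mem_after_farRepair (K := K) (T := T) (j := j) (b := b) (e := e) (c' := c') hjT hc'
    (insert (j.succ, 0) (H₀.filter fun ma => ¬ (ma.1 ∈ ΛT ∧ ma.2 ≠ 0))) (H₀.filter fun ma => ma.1 ∈ ΛT ∧ ma.2 ≠ 0)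
    (fs.filter fun k => k ∈ T ∧ e k = 0) (fs.filter fun k => k ∈ T ∧ e k ≠ 0) (fs.filter fun k => k ∉ T) ?_ ?_ ?_ ?_ ?_ ?_ ?_ ?_ ?_ ?_
  · intro ma hma hm
    rcases Finset.mem_insert.mp hma with rfl | hma
    · rfl
    · by_contra h; exact (Finset.mem_filter.mp hma).2 ⟨hm, h⟩
  · intro m hm a ha
    obtain ⟨hmfs, -⟩ := Finset.mem_filter.mp hm
    rcases Finset.mem_insert.mp ha with h | ha
    · exact absurd (Fin.succ_injective _ (Prod.mk.inj h).1) (fun h' => hjfs (h' ▸ hmfs))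
    · exact hC1 m hmfs a (Finset.mem_filter.mp ha).1
  · intro a ha k hk hbk
    obtain ⟨hkfs, hkT, hek⟩ := Finset.mem_filter.mp hk
    rcases Finset.mem_insert.mp ha with h | ha
    · rw [(Prod.mk.inj h).2, zero_mul]; exact hek
    · obtain ⟨ha0, hna⟩ := Finset.mem_filter.mp ha
      by_cases hz : a = 0
      · rw [hz, zero_mul]; exact hek
      · exact hHj a ha0 hz k hkfs hkT hek hbk
  · intro ma hma; exact (Finset.mem_filter.mp hma).2
  · intro k hk a ha
    have hkfs : k ∈ fs := by
      rcases Finset.mem_union.mp hk with h | h <;> exact (Finset.mem_filter.mp h).1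
    exact hC1 k hkfs a (Finset.mem_filter.mp ha).1
  · intro k hk
    obtain ⟨hkfs, hkT, hek⟩ := Finset.mem_filter.mp hk
    refine ⟨hkT, fun hb => hd k hkfs ?_⟩
    rw [hek, hb, zero_mul, add_zero]
  · intro k hk
    obtain ⟨hkfs, hkT, hek⟩ := Finset.mem_filter.mp hk
    exact ⟨hkT, hek, hd k hkfs⟩
  · intro k hk k' hk' hkk hbk hbk'
    obtain ⟨hkfs, hkT, hek⟩ := Finset.mem_filter.mp hk
    obtain ⟨hk'fs, hk'T, hek'⟩ := Finset.mem_filter.mp hk'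
    exact hNh k hkfs k' hk'fs hkT hk'T hek hek' hkk hbk hbk'
  · intro m hm
    obtain ⟨hmfs, hmT⟩ := Finset.mem_filter.mp hm
    exact ⟨hmT, fun h => hjfs (h ▸ hmfs), hd m hmfs⟩
  · -- the members, read on the chart
    intro D hD
    rw [List.map_append, List.map_map, List.mem_append, List.mem_map, List.map_singleton, List.mem_singleton] at hD
    rcases hD with ⟨D₀, hD₀, rfl⟩ | rfl
    · rcases hE D₀ hD₀ with rfl | ⟨ma, hma, rfl⟩ | ⟨k, hk, rfl⟩
      · left
        simp only [Function.comp_apply]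
        rw [strictTransformIdeal_top, Scheme.IdealSheafData.comap_top]
      · simp only [Function.comp_apply]
        by_cases hmΛT : ma.1 ∈ ΛT
        · by_cases ha : ma.2 = 0
          · -- contains `Σ`: stays the hyperplane `y_m`
            right; left
            refine ⟨ma, Finset.mem_insert_of_mem (Finset.mem_filter.mpr ⟨hma, fun h => h.2 ha⟩), ?_⟩
            have e1 : ma = (ma.1, 0) := Prod.ext rfl ha
            rw [e1]
            exact comap_chartImm_strictTransform_hyperplane_of_mem_after_farRepair hmΛT hjT hπ'
          · -- misses `Σ`: a product quadric
            right; right; left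
            exact ⟨ma, Finset.mem_filter.mpr ⟨hma, hmΛT, ha⟩, comap_chartImm_strictTransform_hyperplane_of_mem_of_ne_after_farRepair hmΛT hjT ha hπ'⟩
        · by_cases hmj : ma.1 = j.succ
          · by_cases ha : ma.2 = 0
            · -- the resonant far hyperplane `y_j`: dies
              left
              have e1 : ma = (j.succ, 0) := Prod.ext hmj ha
              rw [e1]
              exact comap_chartImm_strictTransform_farHyperplane_after_farRepair hπ'
            · right; left
              refine ⟨ma, Finset.mem_insert_of_mem (Finset.mem_filter.mpr ⟨hma, fun h => hmΛT h.1⟩), ?_⟩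
              have e1 : ma = (j.succ, ma.2) := Prod.ext hmj rfl
              rw [e1]
              exact comap_chartImm_strictTransform_hyperplane_j_of_ne_after_farRepair ha hπ'
          · -- an index outside `Σ`'s variables: untouched
            right; left
            refine ⟨ma, Finset.mem_insert_of_mem (Finset.mem_filter.mpr ⟨hma, fun h => hmΛT h.1⟩), ?_⟩
            have hm0 : ma.1 ≠ 0 := fun h => hmΛT (h ▸ Set.mem_insert _ _)
            obtain ⟨i, hi⟩ := Fin.exists_succ_eq.mpr hm0
            have hiS : i ∉ insert j T := fun h => by
              rcases Finset.mem_insert.mp h with h | h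
              · exact hmj (by rw [← hi, h])
              · exact hmΛT (by rw [← hi]; exact Set.mem_insert_of_mem _ ⟨i, Finset.mem_coe.mpr h, rfl⟩)
            have e1 : ma = (i.succ, ma.2) := Prod.ext hi.symm rfl
            rw [e1]
            exact strictTransformIdeal_translate_comap_chartImm hj' hiS ma.2 hπ'
      · simp only [Function.comp_apply]
        by_cases hkT : k ∈ T
        · by_cases hek : e k = 0
          · -- resonant: its strict transform leaves the centre
            right; right; right; left
            have hbk : b k ≠ 0 := fun hb => hd k hk (by rw [hek, hb, zero_mul, add_zero])
            refine ⟨k, Finset.mem_filter.mpr ⟨hk, hkT, hek⟩, ?_⟩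
            rw [hek]
            exact comap_chartImm_strictTransform_resonant_after_farRepair hjT hkT hbk hπ'
          · -- non-resonant in `T`: a cubic
            right; right; right; right; left
            exact ⟨k, Finset.mem_filter.mpr ⟨hk, hkT, hek⟩, comap_chartImm_strictTransform_nonresonant_after_farRepair hjT hkT hek hπ'⟩
        · -- outside `T`: untouched
          right; right; right; right; right
          have hkj : k ≠ j := fun h => hjfs (h ▸ hk)
          exact ⟨k, Finset.mem_filter.mpr ⟨hk, hkT⟩, comap_chartImm_strictTransform_tquadric_of_not_mem_after_farRepair' hkT hkj hc' hπ'⟩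
    · -- the exceptional component of the repair
      right; left
      exact ⟨(j.succ, 0), Finset.mem_insert_self _ _, comap_chartImm_exceptional_after_farRepair hπ'⟩

end ChartDictionary

end Summit.ResolutionOfSingularities.ResolutionOfSingularities.Theorems.PIDim4

end
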